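import Mathlib
import Literature.Analysis.SpecialFunctions.BesselIRealOrder
import HarnessLib

/-!
# The radial heat kernels of real index `ν ≥ 0` ("Bessel-process kernels") and their backward equation

For `ν ≥ 0` and `t, x, y > 0`,
  `q^{(ν)}_t(x,y) = t⁻¹ exp(-(x²+y²)/(2t)) I_ν(xy/t)`     (`besselHeatKernel ν t x y`),
the kernel — with respect to the measure `y dy` on `(0,∞)` — of the semigroup generated by
`L_ν = ½(∂_y² + y⁻¹∂_y) - ν²/(2y²)`: for integer `ν = n` it is the `n`-th angular Fourier mode of the planar
Gaussian kernel, for general `ν` the transition density (up to the factor `(y/x)^ν y`) of the Bessel process of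
index `ν` [RevuzYor1999, Ch. XI §1; Watson 1944, §13.31 (Weber's second exponential integral)].  This file
defines the kernel and its explicit `t`-, `y`- and `yy`-derivatives and proves the BACKWARD/HEAT EQUATION
  `∂_t q = ½ ∂_y² q + (2y)⁻¹ ∂_y q - ν²(2y²)⁻¹ q`      (`besselHeatKernel_pde`)
from Bessel's equation in the contiguity form `u P_{ν+2} + (ν+1)P_{ν+1} = P_ν` (`besselP_three_term`).
Symmetry in `(x,y)` gives the same equation in the left variable.  These are the analytic inputs of the Duhamel
comparison between kernels of different index used for the Hartman–Watson law.

## References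
* D. Revuz, M. Yor, *Continuous Martingales and Brownian Motion*, 3rd ed. (1999), Ch. XI §1. [RevuzYor1999]
* G. N. Watson, *A Treatise on the Theory of Bessel Functions*, 2nd ed. (1944), §13.31. [Watson1944]
* NIST DLMF §10.25. [DLMF]
-/

noncomputable section

open Filter Topology Real
open scoped Nat BigOperators

namespace Literature.Analysis.SpecialFunctions

/-! ## Definitions -/

/-- **The radial heat kernel of index `ν`**: `q^{(ν)}_t(x,y) = t⁻¹ e^{-(x²+y²)/(2t)} I_ν(xy/t)`.
[cite: RevuzYor1999, Ch. XI §1] -/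
def besselHeatKernel (ν t x y : ℝ) : ℝ :=
  t⁻¹ * Real.exp (-(x ^ 2 + y ^ 2) / (2 * t)) * besselIR ν (x * y / t)

/-- The argument `U = (xy/(2t))² = x²y²/(4t²)` of the series `P_ν` in the kernel. [cite: RevuzYor1999, Ch. XI §1] -/
def besselHeatArg (t x y : ℝ) : ℝ := (x * y / (2 * t)) ^ 2

/-- The common prefactor `t⁻¹ e^{-(x²+y²)/(2t)} (xy/(2t))^ν` of the kernel and its derivatives. [cite: RevuzYor1999, Ch. XI §1] -/
def besselHeatPre (ν t x y : ℝ) : ℝ :=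
  t⁻¹ * Real.exp (-(x ^ 2 + y ^ 2) / (2 * t)) * (x * y / (2 * t)) ^ ν

/-- The explicit `t`-derivative of the kernel. [cite: RevuzYor1999, Ch. XI §1] -/
def besselHeatDt (ν t x y : ℝ) : ℝ :=
  besselHeatPre ν t x y *
    ((-(1 + ν) / t + (x ^ 2 + y ^ 2) / (2 * t ^ 2)) * besselP ν (besselHeatArg t x y)
      - (2 * besselHeatArg t x y / t) * besselP (ν + 1) (besselHeatArg t x y))

/-- The explicit `y`-derivative of the kernel. [cite: RevuzYor1999, Ch. XI §1] -/
def besselHeatDy (ν t x y : ℝ) : ℝ :=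
  besselHeatPre ν t x y *
    ((ν / y - y / t) * besselP ν (besselHeatArg t x y)
      + (2 * besselHeatArg t x y / y) * besselP (ν + 1) (besselHeatArg t x y))

/-- The explicit second `y`-derivative of the kernel. [cite: RevuzYor1999, Ch. XI §1] -/
def besselHeatDyy (ν t x y : ℝ) : ℝ :=
  besselHeatPre ν t x y *
    ((-y / t + ν / y) * ((ν / y - y / t) * besselP ν (besselHeatArg t x y)
        + (2 * besselHeatArg t x y / y) * besselP (ν + 1) (besselHeatArg t x y))
      + ((-ν / y ^ 2 - 1 / t) * besselP ν (besselHeatArg t x y)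
        + ((ν / y - y / t) * (2 * besselHeatArg t x y / y) + 2 * besselHeatArg t x y / y ^ 2)
            * besselP (ν + 1) (besselHeatArg t x y)
        + (4 * besselHeatArg t x y ^ 2 / y ^ 2) * besselP (ν + 2) (besselHeatArg t x y)))

/-! ## Elementary properties -/

section Basic

variable {ν t x y : ℝ}

/-- The kernel in terms of the series `P_ν`: `q = t⁻¹ e^{-(x²+y²)/2t} (xy/2t)^ν P_ν((xy/2t)²)`. [cite: DLMF, 10.25.2] -/
theorem besselHeatKernel_eq_pre_mul (ν t x y : ℝ) :
    besselHeatKernel ν t x y = besselHeatPre ν t x y * besselP ν (besselHeatArg t x y) := by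
  unfold besselHeatKernel besselHeatPre besselIR besselHeatArg
  have h1 : x * y / t / 2 = x * y / (2 * t) := by ring
  have h2 : (x * y / t) ^ 2 / 4 = (x * y / (2 * t)) ^ 2 := by ring
  rw [h1, h2]; ring

/-- Symmetry `q_t(x,y) = q_t(y,x)`. [cite: RevuzYor1999, Ch. XI §1] -/
theorem besselHeatKernel_symm (ν t x y : ℝ) : besselHeatKernel ν t x y = besselHeatKernel ν t y x := by
  unfold besselHeatKernel
  rw [add_comm (x ^ 2), mul_comm x y]

/-- Positivity of the prefactor for `t, x, y > 0`. [cite: RevuzYor1999, Ch. XI §1] -/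
theorem besselHeatPre_pos (ν : ℝ) (ht : 0 < t) (hx : 0 < x) (hy : 0 < y) : 0 < besselHeatPre ν t x y := by
  unfold besselHeatPre
  have : 0 < x * y / (2 * t) := by positivity
  exact mul_pos (mul_pos (inv_pos.2 ht) (Real.exp_pos _)) (Real.rpow_pos_of_pos this ν)

/-- **Positivity**: `q^{(ν)}_t(x,y) > 0` for `ν ≥ 0`, `t, x, y > 0`. [cite: RevuzYor1999, Ch. XI §1] -/
theorem besselHeatKernel_pos (hν : 0 ≤ ν) (ht : 0 < t) (hx : 0 < x) (hy : 0 < y) :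
    0 < besselHeatKernel ν t x y := by
  rw [besselHeatKernel_eq_pre_mul]
  exact mul_pos (besselHeatPre_pos ν ht hx hy) (besselP_pos hν (by unfold besselHeatArg; positivity))

/-- **Gaussian majorant**: `q^{(ν)}_t(x,y) ≤ t⁻¹ (xy/2t)^ν e^{-(x-y)²/(2t)} / Γ(ν+1)` (from `I_ν(w) ≤ (w/2)^ν e^w/Γ(ν+1)`).
[cite: DLMF, 10.25.2] -/
theorem besselHeatKernel_le (hν : 0 ≤ ν) (ht : 0 < t) (hx : 0 ≤ x) (hy : 0 ≤ y) :
    besselHeatKernel ν t x y ≤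
      t⁻¹ * (x * y / (2 * t)) ^ ν * Real.exp (-(x - y) ^ 2 / (2 * t)) / Real.Gamma (ν + 1) := by
  unfold besselHeatKernel
  have hw : 0 ≤ x * y / t := by positivity
  have h := besselIR_le_rpow_mul_exp hν hw
  have hG : 0 < Real.Gamma (ν + 1) := Real.Gamma_pos_of_pos (by linarith)
  calc t⁻¹ * Real.exp (-(x ^ 2 + y ^ 2) / (2 * t)) * besselIR ν (x * y / t)
      ≤ t⁻¹ * Real.exp (-(x ^ 2 + y ^ 2) / (2 * t)) * ((x * y / t / 2) ^ ν * Real.exp (x * y / t) / Real.Gamma (ν + 1)) :=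
        mul_le_mul_of_nonneg_left h (by positivity)
    _ = t⁻¹ * (x * y / (2 * t)) ^ ν * Real.exp (-(x - y) ^ 2 / (2 * t)) / Real.Gamma (ν + 1) := by
        rw [show x * y / t / 2 = x * y / (2 * t) by ring]
        have : Real.exp (-(x ^ 2 + y ^ 2) / (2 * t)) * Real.exp (x * y / t) = Real.exp (-(x - y) ^ 2 / (2 * t)) := by
          rw [← Real.exp_add]; congr 1; field_simp; ring
        calc t⁻¹ * Real.exp (-(x ^ 2 + y ^ 2) / (2 * t)) * ((x * y / (2 * t)) ^ ν * Real.exp (x * y / t) / Real.Gamma (ν + 1))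
            = t⁻¹ * (x * y / (2 * t)) ^ ν * (Real.exp (-(x ^ 2 + y ^ 2) / (2 * t)) * Real.exp (x * y / t)) / Real.Gamma (ν + 1) := by
              ring
          _ = _ := by rw [this]

end Basic

/-! ## Derivatives -/

section Deriv

variable {ν t x y : ℝ}

/-- `d/dy (xy/(2t))^ν = (ν/y) (xy/(2t))^ν` for `y > 0`. [folklore] -/
private theorem hasDerivAt_rpow_arg_y (ν : ℝ) (ht : 0 < t) (hx : 0 < x) (hy : 0 < y) :
    HasDerivAt (fun y => (x * y / (2 * t)) ^ ν) (ν / y * (x * y / (2 * t)) ^ ν) y := by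
  have hh : HasDerivAt (fun y => x * y / (2 * t)) (x / (2 * t)) y := by
    have := ((hasDerivAt_id y).const_mul x).div_const (2 * t)
    simpa using this
  have hpos : 0 < x * y / (2 * t) := by positivity
  have h := (Real.hasDerivAt_rpow_const (p := ν) (Or.inl hpos.ne')).comp y hh
  refine h.congr_deriv ?_
  rw [Real.rpow_sub_one hpos.ne']
  have := ht.ne'; have := hx.ne'; have := hy.ne'
  field_simp

/-- `d/dt (xy/(2t))^ν = -(ν/t) (xy/(2t))^ν` for `t > 0`. [folklore] -/
private theorem hasDerivAt_rpow_arg_t (ν : ℝ) (ht : 0 < t) (hx : 0 < x) (hy : 0 < y) :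
    HasDerivAt (fun t => (x * y / (2 * t)) ^ ν) (-(ν / t) * (x * y / (2 * t)) ^ ν) t := by
  have hh : HasDerivAt (fun t => x * y / (2 * t)) (-(x * y / (2 * t ^ 2))) t := by
    have h := (hasDerivAt_inv ht.ne').const_mul (x * y / 2)
    have hfun : (fun s : ℝ => x * y / 2 * s⁻¹) = fun s => x * y / (2 * s) := by
      funext s; ring
    rw [hfun] at h
    refine h.congr_deriv ?_
    have := ht.ne'
    field_simp
  have hpos : 0 < x * y / (2 * t) := by positivity
  have h := (Real.hasDerivAt_rpow_const (p := ν) (Or.inl hpos.ne')).comp t hh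
  refine h.congr_deriv ?_
  rw [Real.rpow_sub_one hpos.ne']
  have := ht.ne'; have := hx.ne'; have := hy.ne'
  field_simp

/-- `d/dy U = 2U/y` with `U = (xy/2t)²`. [folklore] -/
private theorem hasDerivAt_arg_y (ht : 0 < t) (hy : 0 < y) :
    HasDerivAt (fun y => besselHeatArg t x y) (2 * besselHeatArg t x y / y) y := by
  unfold besselHeatArg
  have hh : HasDerivAt (fun y => x * y / (2 * t)) (x / (2 * t)) y := by
    have := ((hasDerivAt_id y).const_mul x).div_const (2 * t)
    simpa using this
  have hsq := hh.pow 2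
  refine hsq.congr_deriv ?_
  have := ht.ne'; have := hy.ne'
  norm_num
  try field_simp
  try ring

/-- `d/dt U = -2U/t`. [folklore] -/
private theorem hasDerivAt_arg_t (ht : 0 < t) (x y : ℝ) :
    HasDerivAt (fun t => besselHeatArg t x y) (-(2 * besselHeatArg t x y / t)) t := by
  unfold besselHeatArg
  have hh : HasDerivAt (fun t => x * y / (2 * t)) (-(x * y / (2 * t ^ 2))) t := by
    have h := (hasDerivAt_inv ht.ne').const_mul (x * y / 2)
    have hfun : (fun s : ℝ => x * y / 2 * s⁻¹) = fun s => x * y / (2 * s) := by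
      funext s; ring
    rw [hfun] at h
    refine h.congr_deriv ?_
    have := ht.ne'
    field_simp
  have hsq := hh.pow 2
  refine hsq.congr_deriv ?_
  have := ht.ne'
  norm_num
  try field_simp
  try ring

/-- The `y`-derivative of the prefactor: `∂_y Pre = (ν/y - y/t) Pre`. [folklore] -/
private theorem hasDerivAt_pre_y (ν : ℝ) (ht : 0 < t) (hx : 0 < x) (hy : 0 < y) :
    HasDerivAt (fun y => besselHeatPre ν t x y) ((ν / y - y / t) * besselHeatPre ν t x y) y := by
  unfold besselHeatPre
  have hE : HasDerivAt (fun y => Real.exp (-(x ^ 2 + y ^ 2) / (2 * t)))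
      (Real.exp (-(x ^ 2 + y ^ 2) / (2 * t)) * (-(y / t))) y := by
    have hsq : HasDerivAt (fun y : ℝ => y ^ 2) (2 * y) y := by simpa using hasDerivAt_pow 2 y
    have h1 : HasDerivAt (fun y => -(x ^ 2 + y ^ 2) / (2 * t)) (-(2 * y) / (2 * t)) y :=
      ((hsq.const_add (x ^ 2)).neg).div_const (2 * t)
    have h2 : -(2 * y) / (2 * t) = -(y / t) := by
      rw [neg_div, mul_div_mul_left y t two_ne_zero]
    rw [h2] at h1
    exact h1.exp
  have h := ((hE.const_mul t⁻¹).mul (hasDerivAt_rpow_arg_y ν ht hx hy))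
  refine h.congr_deriv ?_
  try simp only [Pi.mul_apply]
  have := ht.ne'; have := hy.ne'
  field_simp
  ring

/-- The `t`-derivative of the prefactor: `∂_t Pre = (-(1+ν)/t + (x²+y²)/(2t²)) Pre`. [folklore] -/
private theorem hasDerivAt_pre_t (ν : ℝ) (ht : 0 < t) (hx : 0 < x) (hy : 0 < y) :
    HasDerivAt (fun t => besselHeatPre ν t x y)
      ((-(1 + ν) / t + (x ^ 2 + y ^ 2) / (2 * t ^ 2)) * besselHeatPre ν t x y) t := by
  unfold besselHeatPre
  have hE : HasDerivAt (fun t => Real.exp (-(x ^ 2 + y ^ 2) / (2 * t)))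
      (Real.exp (-(x ^ 2 + y ^ 2) / (2 * t)) * ((x ^ 2 + y ^ 2) / (2 * t ^ 2))) t := by
    have h := (hasDerivAt_inv ht.ne').const_mul (-(x ^ 2 + y ^ 2) / 2)
    have hfun : (fun s : ℝ => -(x ^ 2 + y ^ 2) / 2 * s⁻¹) = fun s => -(x ^ 2 + y ^ 2) / (2 * s) := by
      funext s; ring
    rw [hfun] at h
    have h3 : HasDerivAt (fun t => -(x ^ 2 + y ^ 2) / (2 * t)) ((x ^ 2 + y ^ 2) / (2 * t ^ 2)) t := by
      refine h.congr_deriv ?_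
      have := ht.ne'
      field_simp
      try ring
    exact h3.exp
  have hinv : HasDerivAt (fun t : ℝ => t⁻¹) (-(t ^ 2)⁻¹) t := hasDerivAt_inv ht.ne'
  have h := (hinv.mul hE).mul (hasDerivAt_rpow_arg_t ν ht hx hy)
  refine h.congr_deriv ?_
  try simp only [Pi.mul_apply]
  have := ht.ne'
  field_simp
  ring

/-- **The `y`-derivative of the kernel**: `HasDerivAt (q^{(ν)}_t(x,·)) (besselHeatDy ν t x y) y`.
[cite: RevuzYor1999, Ch. XI §1] -/
theorem hasDerivAt_besselHeatKernel_y (hν : 0 ≤ ν) (ht : 0 < t) (hx : 0 < x) (hy : 0 < y) :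
    HasDerivAt (fun y => besselHeatKernel ν t x y) (besselHeatDy ν t x y) y := by
  have hfun : (fun y => besselHeatKernel ν t x y) = fun y => besselHeatPre ν t x y * besselP ν (besselHeatArg t x y) :=
    funext fun y => besselHeatKernel_eq_pre_mul ν t x y
  rw [hfun]
  have hP : HasDerivAt (fun y => besselP ν (besselHeatArg t x y))
      (besselP (ν + 1) (besselHeatArg t x y) * (2 * besselHeatArg t x y / y)) y :=
    (hasDerivAt_besselP hν _).comp y (hasDerivAt_arg_y ht hy)
  have h := (hasDerivAt_pre_y ν ht hx hy).mul hP
  refine h.congr_deriv ?_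
  try simp only [Pi.mul_apply]
  unfold besselHeatDy
  ring

/-- **The second `y`-derivative of the kernel**: `HasDerivAt (besselHeatDy ν t x ·) (besselHeatDyy ν t x y) y`.
[cite: RevuzYor1999, Ch. XI §1] -/
theorem hasDerivAt_besselHeatDy_y (hν : 0 ≤ ν) (ht : 0 < t) (hx : 0 < x) (hy : 0 < y) :
    HasDerivAt (fun y => besselHeatDy ν t x y) (besselHeatDyy ν t x y) y := by
  unfold besselHeatDy
  have hU := hasDerivAt_arg_y (x := x) ht hy
  have hP0 : HasDerivAt (fun y => besselP ν (besselHeatArg t x y))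
      (besselP (ν + 1) (besselHeatArg t x y) * (2 * besselHeatArg t x y / y)) y :=
    (hasDerivAt_besselP hν _).comp y hU
  have hP1 : HasDerivAt (fun y => besselP (ν + 1) (besselHeatArg t x y))
      (besselP (ν + 1 + 1) (besselHeatArg t x y) * (2 * besselHeatArg t x y / y)) y :=
    (hasDerivAt_besselP (by linarith) _).comp y hU
  have hc1 : HasDerivAt (fun y => ν / y - y / t) (-ν / y ^ 2 - 1 / t) y := by
    have h1 : HasDerivAt (fun y : ℝ => ν / y) (-ν / y ^ 2) y := by
      have := (hasDerivAt_inv hy.ne').const_mul ν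
      refine this.congr_deriv ?_; field_simp
    have h2 : HasDerivAt (fun y : ℝ => y / t) (1 / t) y := by
      have := (hasDerivAt_id y).div_const t
      simpa using this
    exact h1.sub h2
  have hc2 : HasDerivAt (fun y => 2 * besselHeatArg t x y / y)
      (2 * besselHeatArg t x y / y ^ 2) y := by
    have h := (hU.const_mul 2).div (hasDerivAt_id y) hy.ne'
    refine h.congr_deriv ?_
    simp only [id]
    field_simp
    ring
  have hB := (hc1.mul hP0).add (hc2.mul hP1)
  have h := (hasDerivAt_pre_y ν ht hx hy).mul hB
  refine h.congr_deriv ?_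
  try simp only [Pi.mul_apply, Pi.add_apply]
  unfold besselHeatDyy
  rw [show ν + 1 + 1 = ν + 2 by ring]
  ring

/-- **The `t`-derivative of the kernel**: `HasDerivAt (q^{(ν)}_·(x,y)) (besselHeatDt ν t x y) t`.
[cite: RevuzYor1999, Ch. XI §1] -/
theorem hasDerivAt_besselHeatKernel_t (hν : 0 ≤ ν) (ht : 0 < t) (hx : 0 < x) (hy : 0 < y) :
    HasDerivAt (fun t => besselHeatKernel ν t x y) (besselHeatDt ν t x y) t := by
  have hfun : (fun t => besselHeatKernel ν t x y) = fun t => besselHeatPre ν t x y * besselP ν (besselHeatArg t x y) :=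
    funext fun t => besselHeatKernel_eq_pre_mul ν t x y
  rw [hfun]
  have hP : HasDerivAt (fun t => besselP ν (besselHeatArg t x y))
      (besselP (ν + 1) (besselHeatArg t x y) * (-(2 * besselHeatArg t x y / t))) t :=
    (hasDerivAt_besselP hν _).comp t (hasDerivAt_arg_t ht x y)
  have h := (hasDerivAt_pre_t ν ht hx hy).mul hP
  refine h.congr_deriv ?_
  try simp only [Pi.mul_apply]
  unfold besselHeatDt
  ring

/-! ## The heat equation -/

/-- **Backward equation of the radial heat kernel**: for `ν ≥ 0` and `t, x, y > 0`,
`∂_t q^{(ν)}_t(x,y) = ½ ∂_y² q + (2y)⁻¹ ∂_y q - ν² (2y²)⁻¹ q` — Bessel's equation for `I_ν` in the contiguity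
form `U P_{ν+2}(U) + (ν+1) P_{ν+1}(U) = P_ν(U)` at `U = (xy/2t)²`. [cite: RevuzYor1999, Ch. XI §1] -/
theorem besselHeatKernel_pde (hν : 0 ≤ ν) (ht : 0 < t) (hx : 0 < x) (hy : 0 < y) :
    besselHeatDt ν t x y =
      (1 / 2) * besselHeatDyy ν t x y + (1 / (2 * y)) * besselHeatDy ν t x y
        - (ν ^ 2 / (2 * y ^ 2)) * besselHeatKernel ν t x y := by
  rw [besselHeatKernel_eq_pre_mul]
  unfold besselHeatDt besselHeatDyy besselHeatDy
  set U := besselHeatArg t x y with hU_def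
  set A := besselHeatPre ν t x y
  set P0 := besselP ν U
  set P1 := besselP (ν + 1) U
  set P2 := besselP (ν + 2) U
  have h3 : U * P2 + (ν + 1) * P1 = P0 := besselP_three_term hν U
  have hU : U = x ^ 2 * y ^ 2 / (4 * t ^ 2) := by rw [hU_def]; unfold besselHeatArg; field_simp; ring
  have ht' : t ≠ 0 := ht.ne'
  have hy' : y ≠ 0 := hy.ne'
  -- clear denominators and use the contiguity relation
  rw [hU] at h3 ⊢
  field_simp
  field_simp at h3
  linear_combination (-(A * x ^ 2 * y ^ 2)) * h3

end Deriv

end Literature.Analysis.SpecialFunctions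

end
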